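import Mathlib
import HarnessLib

/-!
# Zero-mode action floor — the `L²` Cauchy–Schwarz step (lead c7, line `zero-mode-floor-dilute-gas` of
crux `NestedDissectionSea.EarlyCrosserLaw`, stmt-QuantumFields-13995)

Helper for the registered stub `stub_floorAssembly`: `∫ f g ≤ √(∫ f²) √(∫ g²)` on `ℝ⁴` for a continuous
nonnegative square-integrable `f` and a continuous compactly supported nonnegative `g` (Mathlib's Hölder
inequality `integral_mul_le_Lp_mul_Lq_of_nonneg` at `p = q = 2`, rewritten with square roots).
-/

noncomputable section

open MeasureTheory

namespace Summit.QuantumFields.QCD.Cruxes.EarlyCrosserLaw.ZeroModeFloorDiluteGas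

/-- **`L²` Cauchy–Schwarz.**  `∫ f g ≤ √(∫ f²) · √(∫ g²)` for continuous `f ≥ 0` with `f²` integrable and
continuous compactly supported `g ≥ 0`, on `ℝ⁴`. -/
theorem integral_mul_le_sqrt_mul_sqrt {f g : EuclideanSpace ℝ (Fin 4) → ℝ} (hf : Continuous f)
    (hf0 : ∀ x, 0 ≤ f x) (hf2 : Integrable (fun x => f x ^ 2)) (hg : Continuous g) (hgs : HasCompactSupport g)
    (hg0 : ∀ x, 0 ≤ g x) :
    ∫ x, f x * g x ≤ Real.sqrt (∫ x, f x ^ 2) * Real.sqrt (∫ x, g x ^ 2) := by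
  have hfm : MemLp f (ENNReal.ofReal 2) volume := by
    rw [ENNReal.ofReal_ofNat]
    exact (memLp_two_iff_integrable_sq hf.aestronglyMeasurable).2 hf2
  have hgm : MemLp g (ENNReal.ofReal 2) volume := by
    rw [ENNReal.ofReal_ofNat]
    exact hg.memLp_of_hasCompactSupport hgs
  have h := integral_mul_le_Lp_mul_Lq_of_nonneg Real.HolderConjugate.two_two (ae_of_all _ hf0)
    (ae_of_all _ hg0) hfm hgm
  have e1 : ∀ u : EuclideanSpace ℝ (Fin 4) → ℝ, (∫ x, u x ^ (2 : ℝ)) ^ (1 / (2 : ℝ)) = Real.sqrt (∫ x, u x ^ 2) := by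
    intro u
    rw [Real.sqrt_eq_rpow]
    congr 1
    exact integral_congr_ae (ae_of_all _ fun x => Real.rpow_two _)
  rw [e1 f, e1 g] at h
  exact h

end Summit.QuantumFields.QCD.Cruxes.EarlyCrosserLaw.ZeroModeFloorDiluteGas

end
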